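import Mathlib
import Literature.Geometry.DiscreteGeometry.TwoShellPatterns
import Literature.MathematicalPhysics.StatisticalMechanics.BarlowStacking
import Summits.AtomisticToContinuum.Crystallization.Theorems.NashClassCertificatesNashNearFieldStubChartCoreBridge

/-!
# Crux `NashClassCertificates.NashNearField` (stmt-AtomisticToContinuum-16827), line `birth`,
# stub `stub_chartCore` — part 2: the ASSEMBLY (clauses (iii)+(iv) from a per-pivot placement)

`stub_chartCore` (shared verbatim with the twin crux stmt-13958) asks, at a particle `i` whose 3-ball is
1/20-good and whose goodness is witnessed by `(a, A, P, f)`, for a frame `R` and a Hägg word `s` with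
(i) `P ⊆ R(sites)`, (ii) non-zero central sites `↦ P`, (iii) every particle within `141/100` of a pattern
neighbour `x (f v)` (and within `2` of `x i`) is within `2/5` of `x i + a • A (R site)`, and (iv) every site of
norm `≤ 43/20` within `3/2` of the central site of `v` has a particle within `2/5`.

This file REDUCES the stub to its combinatorial heart, the **placement property**
(`stub_chartCore_of_placement`): it suffices to produce `R`, `s` with (i), (ii) and, for every pivot
`v ∈ P`, ONE goodness witness `(a', A', P', f')` of the neighbour `f v` such that every pattern particle
`f' w` (`w ∈ P'`) of that neighbour lies within `2/5` of `x i + a • A (R b_w)` for some template site `b_w`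
with `R b_w ≠ v`, `dist (R b_w) v ≤ 3/2`.  No quantitative bookkeeping beyond that survives:

* (iii): a particle within `141/100 ≤ 3a'/2` of `x (f v)` is `f v` itself (site of `v`, error `a/20`) or a
  pattern particle `f' w` of it (completeness clause of the neighbour), placed by hypothesis.
* (iv): write `v = R v⋆` (clause (i)).  The sites `b ≠ v⋆` with `‖b − v⋆‖ ≤ 3/2` are, after RE-CENTRING
  the template at `v⋆` (`barlowPos_sub_barlowPos`: `b − v⋆` is a site of the SHIFTED word `k ↦ s (k + m₀)`,
  again a Hägg word), the non-zero central sites of a Barlow template, which the bridge of part 1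
  (`chartCoreBridge_fcc/hcp`) maps injectively into an 18-point pattern.  The assignment `w ↦ b_w − v⋆` is
  injective on the 18-point pattern `P'` (two pattern particles within `2/5` of one point would be `< 0.846`
  apart), so by counting it is ONTO the central sites: the prescribed `b` is some `b_w`, and `f' w` is the
  wanted particle.

The remaining obligation — the placement property itself (robust pair lemma, letters of layers `±2`,
normal selection for fcc-type centres) — is recorded verbatim as the hypothesis of
`stub_chartCore_of_placement`.
-/

noncomputable section

open Literature.MathematicalPhysics.StatisticalMechanics Literature.Geometry.DiscreteGeometry

namespace Summit.AtomisticToContinuum.Crystallization.Theorems.NashClassCertificatesNashNearField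

/-! ### Re-centring a Barlow template at one of its sites -/

/-- Letters of the shifted word `k ↦ s (k + m₀)`: `L' n = L (n + m₀) - L m₀`. -/
theorem haggLabel_shift (s : ℤ → ℤ) (m₀ n : ℤ) :
    haggLabel (fun k => s (k + m₀)) n = haggLabel s (n + m₀) - haggLabel s m₀ := by
  induction n using Int.induction_on with
  | zero => simp
  | succ n ih =>
    rw [haggLabel_succ, ih, show (n : ℤ) + 1 + m₀ = (n + m₀) + 1 by ring, haggLabel_succ]
    ring
  | pred n ih =>
    have h1 := haggLabel_succ (fun k => s (k + m₀)) (-(n : ℤ) - 1)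
    have h2 := haggLabel_succ s (-(n : ℤ) - 1 + m₀)
    rw [show -(n : ℤ) - 1 + 1 = -n by ring] at h1
    rw [show -(n : ℤ) - 1 + m₀ + 1 = -n + m₀ by ring] at h2
    rw [h1, h2] at ih
    linarith

/-- The shifted word is again a Hägg word. -/
theorem isHaggSeq_shift {s : ℤ → ℤ} (hs : IsHaggSeq s) (m₀ : ℤ) : IsHaggSeq (fun k => s (k + m₀)) :=
  fun k => hs (k + m₀)

/-- **Re-centring**: the difference of two template sites is a site of the template of the shifted word,
`barlowPos s m u w - barlowPos s m₀ u₀ w₀ = barlowPos (s (· + m₀)) (m - m₀) (u - u₀) (w - w₀)`. -/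
theorem barlowPos_sub_barlowPos (a h : ℝ) (s : ℤ → ℤ) (m₀ u₀ w₀ m u w : ℤ) :
    barlowPos a h s m u w - barlowPos a h s m₀ u₀ w₀ =
      barlowPos a h (fun k => s (k + m₀)) (m - m₀) (u - u₀) (w - w₀) := by
  have hL : haggLabel (fun k => s (k + m₀)) (m - m₀) = haggLabel s m - haggLabel s m₀ := by
    rw [haggLabel_shift, sub_add_cancel]
  ext l
  fin_cases l <;> simp [hL] <;> ring

/-! ### Counting: an injective placement into the central sites is onto -/

/-- The bridge of part 1 for an arbitrary Hägg word, with the pattern as an anonymous 18-point set. -/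
theorem exists_bridge_eighteen {s : ℤ → ℤ} (hs : IsHaggSeq s) :
    ∃ (R : EuclideanSpace ℝ (Fin 3) →ₗᵢ[ℝ] EuclideanSpace ℝ (Fin 3)) (Q : Finset (EuclideanSpace ℝ (Fin 3))),
      Q.card = 18 ∧
      (∀ m u w : ℤ, ‖barlowPos 1 (Real.sqrt 6 / 3) s m u w‖ ≤ 3 / 2 →
        barlowPos 1 (Real.sqrt 6 / 3) s m u w ≠ 0 → R (barlowPos 1 (Real.sqrt 6 / 3) s m u w) ∈ Q) := by
  by_cases h : s (-1) = s 0
  · obtain ⟨R, -, h2⟩ := chartCoreBridge_fcc hs h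
    exact ⟨R, fccTwoShellPattern, card_fccTwoShellPattern, h2⟩
  · obtain ⟨R, -, h2⟩ := chartCoreBridge_hcp hs h
    exact ⟨R, hcpTwoShellPattern, card_hcpTwoShellPattern, h2⟩

/-- **Counting lemma.**  If `g` maps an 18-point set `P'` injectively into the non-zero central sites
(norm `≤ 3/2`) of the Barlow template of a Hägg word, then `g` is ONTO those sites. -/
theorem exists_eq_of_injOn_central {s : ℤ → ℤ} (hs : IsHaggSeq s) {P' : Finset (EuclideanSpace ℝ (Fin 3))}
    (hP' : P'.card = 18) {g : EuclideanSpace ℝ (Fin 3) → EuclideanSpace ℝ (Fin 3)}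
    (hg : ∀ w ∈ P', (∃ m u w' : ℤ, g w = barlowPos 1 (Real.sqrt 6 / 3) s m u w') ∧ g w ≠ 0 ∧ ‖g w‖ ≤ 3 / 2)
    (hinj : Set.InjOn g ↑P') {m u w' : ℤ} (hc0 : barlowPos 1 (Real.sqrt 6 / 3) s m u w' ≠ 0)
    (hc : ‖barlowPos 1 (Real.sqrt 6 / 3) s m u w'‖ ≤ 3 / 2) :
    ∃ w ∈ P', g w = barlowPos 1 (Real.sqrt 6 / 3) s m u w' := by
  classical
  obtain ⟨R, Q, hQ, hii⟩ := exists_bridge_eighteen hs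
  have hsub : P'.image (fun w => R (g w)) ⊆ Q := by
    intro q hq
    obtain ⟨w, hw, rfl⟩ := Finset.mem_image.1 hq
    obtain ⟨⟨m₁, u₁, w₁, h₁⟩, h0, hle⟩ := hg w hw
    rw [h₁] at h0 hle ⊢
    exact hii m₁ u₁ w₁ hle h0
  have hinj' : Set.InjOn (fun w => R (g w)) ↑P' := fun w hw w₂ hw₂ h =>
    hinj hw hw₂ (R.injective h)
  have hcard : (P'.image fun w => R (g w)).card = 18 := by rw [Finset.card_image_of_injOn hinj', hP']
  have heq : P'.image (fun w => R (g w)) = Q :=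
    Finset.eq_of_subset_of_card_le hsub (by rw [hcard, hQ])
  have hmem : R (barlowPos 1 (Real.sqrt 6 / 3) s m u w') ∈ P'.image fun w => R (g w) := by
    rw [heq]; exact hii m u w' hc hc0
  obtain ⟨w, hw, h⟩ := Finset.mem_image.1 hmem
  exact ⟨w, hw, R.injective h⟩

/-! ### Pattern facts -/

/-- Distinct points of a two-shell pattern are at distance `≥ 1`. -/
theorem one_le_dist_of_mem_twoShellPattern {P : Finset (EuclideanSpace ℝ (Fin 3))}
    (hP : P = fccTwoShellPattern ∨ P = hcpTwoShellPattern) {v w : EuclideanSpace ℝ (Fin 3)}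
    (hv : v ∈ P) (hw : w ∈ P) (hvw : v ≠ w) : 1 ≤ dist v w := by
  rcases hP with rfl | rfl
  · exact one_le_dist_of_mem_fccTwoShellPattern hv hw hvw
  · exact one_le_dist_of_mem_hcpTwoShellPattern hv hw hvw

/-- **Two pattern particles of a good particle within `2/5` of one point coincide**: distinct pattern points
are `≥ a'` apart and the particles sit within `a'/20` of them, `a' ≥ 47/50`, while `2·(2/5) + a'/10 < a'`. -/
theorem eq_of_dist_le_two_fifths {N : ℕ} {x : Fin N → EuclideanSpace ℝ (Fin 3)} {j : Fin N} {a' : ℝ}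
    {A' : EuclideanSpace ℝ (Fin 3) →ₗᵢ[ℝ] EuclideanSpace ℝ (Fin 3)} {P' : Finset (EuclideanSpace ℝ (Fin 3))}
    {f' : EuclideanSpace ℝ (Fin 3) → Fin N} (ha' : 47 / 50 ≤ a')
    (hP' : P' = fccTwoShellPattern ∨ P' = hcpTwoShellPattern)
    (hf' : ∀ w ∈ P', f' w ≠ j ∧ dist (x (f' w)) (x j + a' • A' w) ≤ 1 / 20 * a')
    {w w₂ : EuclideanSpace ℝ (Fin 3)} (hw : w ∈ P') (hw₂ : w₂ ∈ P') {p : EuclideanSpace ℝ (Fin 3)}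
    (h1 : dist (x (f' w)) p ≤ 2 / 5) (h2 : dist (x (f' w₂)) p ≤ 2 / 5) : w = w₂ := by
  by_contra hne
  have hd : 1 ≤ dist w w₂ := one_le_dist_of_mem_twoShellPattern hP' hw hw₂ hne
  have ha0 : 0 < a' := by linarith
  have hframe : dist (x j + a' • A' w) (x j + a' • A' w₂) = a' * dist w w₂ := by
    rw [dist_eq_norm, add_sub_add_left_eq_sub, ← smul_sub, norm_smul, Real.norm_of_nonneg ha0.le,
      ← map_sub, A'.norm_map, ← dist_eq_norm]
  have htri : dist (x j + a' • A' w) (x j + a' • A' w₂) ≤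
      dist (x (f' w)) (x j + a' • A' w) + dist (x (f' w)) p + (dist (x (f' w₂)) p +
        dist (x (f' w₂)) (x j + a' • A' w₂)) := by
    have := dist_triangle4 (x j + a' • A' w) (x (f' w)) p (x j + a' • A' w₂)
    rw [dist_comm (x j + a' • A' w) (x (f' w))] at this
    linarith [dist_triangle p (x (f' w₂)) (x j + a' • A' w₂), dist_comm p (x (f' w₂))]
  have hb := (hf' w hw).2
  have hb₂ := (hf' w₂ hw₂).2
  rw [hframe] at htri
  nlinarith

/-! ### The assembly -/

/-- **`stub_chartCore` from the placement property.**  If at every particle whose 3-ball is 1/20-good one can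
exhibit a frame `R`, a Hägg word `s` with the two bridge clauses (i), (ii), and for every pivot `v ∈ P` a
goodness witness of the neighbour `f v` all of whose pattern particles are placed within `2/5` of template
sites adjacent to the central site of `v` (`R b ≠ v`, `dist (R b) v ≤ 3/2`), then `stub_chartCore` holds. -/
theorem stub_chartCore_of_placement
    (hpl : ∀ (N : ℕ) (x : Fin N → EuclideanSpace ℝ (Fin 3)) (i : Fin N),
      (∀ k : Fin N, dist (x k) (x i) ≤ 3 → IsTwoShellGood (1 / 20) (47 / 50) 1 x k) →
      ∀ (a : ℝ) (A : EuclideanSpace ℝ (Fin 3) →ₗᵢ[ℝ] EuclideanSpace ℝ (Fin 3)) (P : Finset (EuclideanSpace ℝ (Fin 3)))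
        (f : EuclideanSpace ℝ (Fin 3) → Fin N),
        47 / 50 ≤ a → a ≤ 1 → (P = fccTwoShellPattern ∨ P = hcpTwoShellPattern) →
        (∀ v ∈ P, f v ≠ i ∧ dist (x (f v)) (x i + a • A v) ≤ 1 / 20 * a) → Set.InjOn f ↑P →
        (∀ j : Fin N, j ≠ i → dist (x j) (x i) ≤ 3 / 2 * a → ∃ v ∈ P, f v = j) →
        ∃ (R : EuclideanSpace ℝ (Fin 3) →ₗᵢ[ℝ] EuclideanSpace ℝ (Fin 3)) (s : ℤ → ℤ), IsHaggSeq s ∧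
          (∀ v ∈ P, ∃ m u w : ℤ, R (barlowPos 1 (Real.sqrt 6 / 3) s m u w) = v) ∧
          (∀ m u w : ℤ, ‖barlowPos 1 (Real.sqrt 6 / 3) s m u w‖ ≤ 3 / 2 → barlowPos 1 (Real.sqrt 6 / 3) s m u w ≠ 0 →
            R (barlowPos 1 (Real.sqrt 6 / 3) s m u w) ∈ P) ∧
          (∀ v ∈ P, ∃ (a' : ℝ) (A' : EuclideanSpace ℝ (Fin 3) →ₗᵢ[ℝ] EuclideanSpace ℝ (Fin 3))
            (P' : Finset (EuclideanSpace ℝ (Fin 3))) (f' : EuclideanSpace ℝ (Fin 3) → Fin N),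
            47 / 50 ≤ a' ∧ a' ≤ 1 ∧ (P' = fccTwoShellPattern ∨ P' = hcpTwoShellPattern) ∧
            (∀ w ∈ P', f' w ≠ f v ∧ dist (x (f' w)) (x (f v) + a' • A' w) ≤ 1 / 20 * a') ∧ Set.InjOn f' ↑P' ∧
            (∀ k : Fin N, k ≠ f v → dist (x k) (x (f v)) ≤ 3 / 2 * a' → ∃ w ∈ P', f' w = k) ∧
            (∀ w ∈ P', ∃ m u w' : ℤ, R (barlowPos 1 (Real.sqrt 6 / 3) s m u w') ≠ v ∧
              dist (R (barlowPos 1 (Real.sqrt 6 / 3) s m u w')) v ≤ 3 / 2 ∧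
              dist (x (f' w)) (x i + a • A (R (barlowPos 1 (Real.sqrt 6 / 3) s m u w'))) ≤ 2 / 5))) :
    ∀ (N : ℕ) (x : Fin N → EuclideanSpace ℝ (Fin 3)) (i : Fin N),
      (∀ k : Fin N, dist (x k) (x i) ≤ 3 → IsTwoShellGood (1 / 20) (47 / 50) 1 x k) →
      ∀ (a : ℝ) (A : EuclideanSpace ℝ (Fin 3) →ₗᵢ[ℝ] EuclideanSpace ℝ (Fin 3)) (P : Finset (EuclideanSpace ℝ (Fin 3))) (f : EuclideanSpace ℝ (Fin 3) → Fin N),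
        47 / 50 ≤ a → a ≤ 1 → (P = fccTwoShellPattern ∨ P = hcpTwoShellPattern) →
        (∀ v ∈ P, f v ≠ i ∧ dist (x (f v)) (x i + a • A v) ≤ 1 / 20 * a) → Set.InjOn f ↑P →
        (∀ j : Fin N, j ≠ i → dist (x j) (x i) ≤ 3 / 2 * a → ∃ v ∈ P, f v = j) →
        ∃ (R : EuclideanSpace ℝ (Fin 3) →ₗᵢ[ℝ] EuclideanSpace ℝ (Fin 3)) (s : ℤ → ℤ), IsHaggSeq s ∧
          (∀ v ∈ P, ∃ m u w : ℤ, R (barlowPos 1 (Real.sqrt 6 / 3) s m u w) = v) ∧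
          (∀ m u w : ℤ, ‖barlowPos 1 (Real.sqrt 6 / 3) s m u w‖ ≤ 3 / 2 → barlowPos 1 (Real.sqrt 6 / 3) s m u w ≠ 0 → R (barlowPos 1 (Real.sqrt 6 / 3) s m u w) ∈ P) ∧
          (∀ v ∈ P, ∀ k : Fin N, dist (x k) (x (f v)) ≤ 141 / 100 → dist (x k) (x i) ≤ 2 →
            ∃ m u w : ℤ, dist (x k) (x i + a • A (R (barlowPos 1 (Real.sqrt 6 / 3) s m u w))) ≤ 2 / 5) ∧
          (∀ v ∈ P, ∀ m u w : ℤ, ‖barlowPos 1 (Real.sqrt 6 / 3) s m u w‖ ≤ 43 / 20 → dist (R (barlowPos 1 (Real.sqrt 6 / 3) s m u w)) v ≤ 3 / 2 →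
            ∃ k : Fin N, dist (x k) (x i + a • A (R (barlowPos 1 (Real.sqrt 6 / 3) s m u w))) ≤ 2 / 5) := by
  intro N x i hgood a A P f ha1 ha2 hP hf hinj hcomp
  obtain ⟨R, s, hs, h1, h2, hpiv⟩ := hpl N x i hgood a A P f ha1 ha2 hP hf hinj hcomp
  refine ⟨R, s, hs, h1, h2, fun v hv k hk1 _ => ?_, fun v hv m u w _ hdist => ?_⟩
  · -- (iii)
    obtain ⟨a', A', P', f', ha1', -, -, -, -, hcomp', hplace⟩ := hpiv v hv
    by_cases hkj : k = f v
    · subst hkj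
      obtain ⟨m, u, w, hR⟩ := h1 v hv
      refine ⟨m, u, w, ?_⟩
      rw [hR]
      calc dist (x (f v)) (x i + a • A v) ≤ 1 / 20 * a := (hf v hv).2
        _ ≤ 2 / 5 := by linarith
    · have hk' : dist (x k) (x (f v)) ≤ 3 / 2 * a' := hk1.trans (by linarith)
      obtain ⟨w, hw, rfl⟩ := hcomp' k hkj hk'
      obtain ⟨m, u, w', -, -, hd⟩ := hplace w hw
      exact ⟨m, u, w', hd⟩
  · -- (iv)
    obtain ⟨a', A', P', f', ha1', -, hP', hf', -, -, hplace⟩ := hpiv v hv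
    by_cases hbv : R (barlowPos 1 (Real.sqrt 6 / 3) s m u w) = v
    · refine ⟨f v, ?_⟩
      rw [hbv]
      calc dist (x (f v)) (x i + a • A v) ≤ 1 / 20 * a := (hf v hv).2
        _ ≤ 2 / 5 := by linarith
    · -- the central site `v⋆` of `v` and the re-centred word
      obtain ⟨m₀, u₀, w₀, hv0⟩ := h1 v hv
      classical
      choose! gm gu gw hg using hplace
      set s' : ℤ → ℤ := fun k => s (k + m₀) with hs'def
      have hs' : IsHaggSeq s' := isHaggSeq_shift hs m₀
      set v0 := barlowPos 1 (Real.sqrt 6 / 3) s m₀ u₀ w₀ with hv0def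
      -- the placement map, re-centred
      set g : EuclideanSpace ℝ (Fin 3) → EuclideanSpace ℝ (Fin 3) :=
        fun w' => barlowPos 1 (Real.sqrt 6 / 3) s (gm w') (gu w') (gw w') - v0 with hgdef
      have hgsite : ∀ w' ∈ P', (∃ m u w₁ : ℤ, g w' = barlowPos 1 (Real.sqrt 6 / 3) s' m u w₁) ∧ g w' ≠ 0 ∧
          ‖g w'‖ ≤ 3 / 2 := by
        intro w' hw'
        obtain ⟨hne, hle, -⟩ := hg w' hw'
        refine ⟨⟨gm w' - m₀, gu w' - u₀, gw w' - w₀, barlowPos_sub_barlowPos _ _ _ _ _ _ _ _ _⟩, ?_, ?_⟩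
        · intro h0
          apply hne
          rw [hgdef] at h0
          simp only at h0
          rw [sub_eq_zero] at h0
          rw [h0, ← hv0]
        · rw [hgdef]
          simp only
          rw [← dist_eq_norm, ← R.dist_map, hv0]
          exact hle
      have hginj : Set.InjOn g ↑P' := by
        intro w' hw' w₂ hw₂ heq
        have heq' : barlowPos 1 (Real.sqrt 6 / 3) s (gm w') (gu w') (gw w') =
            barlowPos 1 (Real.sqrt 6 / 3) s (gm w₂) (gu w₂) (gw w₂) := by
          simpa [hgdef] using heq
        obtain ⟨-, -, hd1⟩ := hg w' hw'
        obtain ⟨-, -, hd2⟩ := hg w₂ hw₂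
        rw [heq'] at hd1
        exact eq_of_dist_le_two_fifths ha1' hP' hf' hw' hw₂ hd1 hd2
      -- the prescribed site, re-centred
      have hb : barlowPos 1 (Real.sqrt 6 / 3) s m u w - v0 = barlowPos 1 (Real.sqrt 6 / 3) s' (m - m₀) (u - u₀) (w - w₀) :=
        barlowPos_sub_barlowPos _ _ _ _ _ _ _ _ _
      have hb0 : barlowPos 1 (Real.sqrt 6 / 3) s' (m - m₀) (u - u₀) (w - w₀) ≠ 0 := by
        rw [← hb, sub_ne_zero]
        intro h0
        exact hbv (by rw [h0, hv0])
      have hble : ‖barlowPos 1 (Real.sqrt 6 / 3) s' (m - m₀) (u - u₀) (w - w₀)‖ ≤ 3 / 2 := by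
        rw [← hb, ← dist_eq_norm, ← R.dist_map, hv0]
        exact hdist
      obtain ⟨w', hw', hgw⟩ := exists_eq_of_injOn_central hs' (card_eq_eighteen_of_twoShellPattern hP')
        hgsite hginj hb0 hble
      refine ⟨f' w', ?_⟩
      obtain ⟨-, -, hd⟩ := hg w' hw'
      have : barlowPos 1 (Real.sqrt 6 / 3) s (gm w') (gu w') (gw w') = barlowPos 1 (Real.sqrt 6 / 3) s m u w := by
        rw [← hb, hgdef] at hgw
        simpa using hgw
      rw [this] at hd
      exact hd

/-- **Registered sub-goal `stub_chartCoreAssembly` of crux stmt-AtomisticToContinuum-16827** (the reduction of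
`stub_chartCore` to the placement property): landing anchor of this file, re-exporting
`stub_chartCore_of_placement`. -/
theorem stub_chartCoreAssembly : (∀ (N : ℕ) (x : Fin N → EuclideanSpace ℝ (Fin 3)) (i : Fin N), (∀ k : Fin N, dist (x k) (x i) ≤ 3 → IsTwoShellGood (1 / 20) (47 / 50) 1 x k) → ∀ (a : ℝ) (A : EuclideanSpace ℝ (Fin 3) →ₗᵢ[ℝ] EuclideanSpace ℝ (Fin 3)) (P : Finset (EuclideanSpace ℝ (Fin 3))) (f : EuclideanSpace ℝ (Fin 3) → Fin N), 47 / 50 ≤ a → a ≤ 1 → (P = fccTwoShellPattern ∨ P = hcpTwoShellPattern) → (∀ v ∈ P, f v ≠ i ∧ dist (x (f v)) (x i + a • A v) ≤ 1 / 20 * a) → Set.InjOn f ↑P → (∀ j : Fin N, j ≠ i → dist (x j) (x i) ≤ 3 / 2 * a → ∃ v ∈ P, f v = j) → ∃ (R : EuclideanSpace ℝ (Fin 3) →ₗᵢ[ℝ] EuclideanSpace ℝ (Fin 3)) (s : ℤ → ℤ), IsHaggSeq s ∧ (∀ v ∈ P, ∃ m u w : ℤ, R (barlowPos 1 (Real.sqrt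 6 / 3) s m u w) = v) ∧ (∀ m u w : ℤ, ‖barlowPos 1 (Real.sqrt 6 / 3) s m u w‖ ≤ 3 / 2 → barlowPos 1 (Real.sqrt 6 / 3) s m u w ≠ 0 → R (barlowPos 1 (Real.sqrt 6 / 3) s m u w) ∈ P) ∧ (∀ v ∈ P, ∃ (a' : ℝ) (A' : EuclideanSpace ℝ (Fin 3) →ₗᵢ[ℝ] EuclideanSpace ℝ (Fin 3)) (P' : Finset (EuclideanSpace ℝ (Fin 3))) (f' : EuclideanSpace ℝ (Fin 3) → Fin N), 47 / 50 ≤ a' ∧ a' ≤ 1 ∧ (P' = fccTwoShellPattern ∨ P' = hcpTwoShellPattern) ∧ (∀ w ∈ P', f' w ≠ f v ∧ dist (x (f' w)) (x (f v) + a' • A' w) ≤ 1 / 20 * a') ∧ Set.InjOn f' ↑P' ∧ (∀ k : Fin N, k ≠ f v → dist (x k) (x (f v)) ≤ 3 / 2 * a' → ∃ w ∈ P', f' w = k) ∧ (∀ w ∈ P', ∃ m u w' : ℤ, R (barlowPos 1 (Real.sqrt 6 / 3) s m u w') ≠ v ∧ dist (R (barlowPos 1 (Real.sqrt 6 / 3)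 s m u w')) v ≤ 3 / 2 ∧ dist (x (f' w)) (x i + a • A (R (barlowPos 1 (Real.sqrt 6 / 3) s m u w'))) ≤ 2 / 5))) → ∀ (N : ℕ) (x : Fin N → EuclideanSpace ℝ (Fin 3)) (i : Fin N), (∀ k : Fin N, dist (x k) (x i) ≤ 3 → IsTwoShellGood (1 / 20) (47 / 50) 1 x k) → ∀ (a : ℝ) (A : EuclideanSpace ℝ (Fin 3) →ₗᵢ[ℝ] EuclideanSpace ℝ (Fin 3)) (P : Finset (EuclideanSpace ℝ (Fin 3))) (f : EuclideanSpace ℝ (Fin 3) → Fin N), 47 / 50 ≤ a → a ≤ 1 → (P = fccTwoShellPattern ∨ P = hcpTwoShellPattern) → (∀ v ∈ P, f v ≠ i ∧ dist (x (f v)) (x i + a • A v) ≤ 1 / 20 * a) → Set.InjOn f ↑P → (∀ j : Fin N, j ≠ i → dist (x j) (x i) ≤ 3 / 2 * a → ∃ v ∈ P, f v = j) → ∃ (R : EuclideanSpace ℝ (Fin 3) →ₗᵢ[ℝ] EuclideanSpace ℝ (Fin 3)) (s : ℤ → ℤ), IsHaggSeq s ∧ (∀ v ∈ P, ∃ m u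 w : ℤ, R (barlowPos 1 (Real.sqrt 6 / 3) s m u w) = v) ∧ (∀ m u w : ℤ, ‖barlowPos 1 (Real.sqrt 6 / 3) s m u w‖ ≤ 3 / 2 → barlowPos 1 (Real.sqrt 6 / 3) s m u w ≠ 0 → R (barlowPos 1 (Real.sqrt 6 / 3) s m u w) ∈ P) ∧ (∀ v ∈ P, ∀ k : Fin N, dist (x k) (x (f v)) ≤ 141 / 100 → dist (x k) (x i) ≤ 2 → ∃ m u w : ℤ, dist (x k) (x i + a • A (R (barlowPos 1 (Real.sqrt 6 / 3) s m u w))) ≤ 2 / 5) ∧ (∀ v ∈ P, ∀ m u w : ℤ, ‖barlowPos 1 (Real.sqrt 6 / 3) s m u w‖ ≤ 43 / 20 → dist (R (barlowPos 1 (Real.sqrt 6 / 3) s m u w)) v ≤ 3 / 2 → ∃ k : Fin N, dist (x k) (x i + a • A (R (barlowPos 1 (Real.sqrt 6 / 3) s m u w))) ≤ 2 / 5) :=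
  stub_chartCore_of_placement

end Summit.AtomisticToContinuum.Crystallization.Theorems.NashClassCertificatesNashNearField

end
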